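import Summits.FinalStateConjecture.FinalStateConjecture.Theorems.EIHFluxBalanceInertialRecessionStubIdentificationDefect
import Summits.FinalStateConjecture.FinalStateConjecture.Theorems.EIHFluxBalanceInertialRecessionStubChargeModelBackground
import Summits.FinalStateConjecture.FinalStateConjecture.Theorems.EIHFluxBalanceInertialRecessionStubChargeModelUnpack

/-!
# Route EIHFluxBalance — `InertialRecession`, line `sublinear-is-free-clean-window-charges`:
# pointwise comparison of painted and frozen summands on a slice (stub `stub_identification`, part A5b)

Helper file (`--supports stmt-FinalStateConjecture-10166`) for the crux
`Summit.FinalStateConjecture.FinalStateConjecture.Theses.EIHFluxBalance.InertialRecession`.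

Rotation-blind pointwise estimates feeding the small-sphere comparison of the identification (the
lab metric against the frozen boosted field of hole `j` on the sphere `{|y − ξ_j(t)| = ρ₀}`):
* `opNorm_fderiv_sub_le_of_eqOn_slice` — two fields agreeing on the slice `{z⁰ = x⁰}` have
  `‖Df(x) − Dg(x)‖ ≤ ‖Df(x)e₀ − Dg(x)e₀‖` (spatial derivatives agree,
  `KSDecay.fderiv_apply_eq_of_eqOn_slice`);
* `painted_eq_frozen_of_apply_zero` — on the slice the painted summand of hole `i` IS the frozen
  field `boostedKerrBilin (Λ i t) (t, ξ i t) M a`, so `‖D(painted)(x) − D(frozen)(x)‖` is the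
  modulation defect of `…Defect` (`opNorm_fderiv_painted_sub_frozen_le`);
* `norm_frozen_sub_minkowski_le` — the value bound `‖boostedKerrBilin Λ (x⁰, ξ₀) M a x − η‖
  ≤ |M| B₀ ‖Λ⁻¹‖² / ‖x̃ − ξ₀‖` at lab distance `≥ max 1 (2|a|)`;
* `norm_fderiv_frozen_le` — the derivative bound `‖D(boostedKerrBilin Λ (x⁰, ξ₀) M a)(x)‖ ≤
  C ‖Λ⁻¹‖³ / ‖x̃ − ξ₀‖²` at lab distance `≥ R₀ + |a|` (`KSDecay.norm_fderiv_boostedKerrBilin_le`);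
* `mem_ball_of_spatialNorm_poincareInv_le` — the enclosure hypothesis of
  `quasiLocalMomentum_boostedKerr_*` for the sphere about the painted centre: the lab trace of the
  rest-frame ball `{|z| ≤ |a|}` lies in `ball (ξ₀) ρ₀` once `|a| < ρ₀`.
[cite: KerrSchild1965, §3]
-/

set_option linter.dupNamespace false
-- instance search on the nested operator spaces `E4 →L[ℝ] E4 →L[ℝ] ℝ` is deep
set_option maxSynthPendingDepth 3

noncomputable section

namespace Summit.FinalStateConjecture.FinalStateConjecture.Theorems.SublinearIsFree.ChargeModel

open scoped BigOperators Topology ContDiff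
open Filter Set Metric Function Literature.Geometry.Lorentzian
open Summit.FinalStateConjecture.FinalStateConjecture.Theorems
open Summit.FinalStateConjecture.FinalStateConjecture.Theorems.InertialRecession.Negative
open SublinearIsFree.QuasiStationarity SublinearIsFree.Slaving

/-! ### Fields agreeing on a slice -/

/-- **Two fields agreeing on a time slice differ, to first order, only in `∂₀`**:
`‖Df(x) − Dg(x)‖ ≤ ‖Df(x)e₀ − Dg(x)e₀‖`. [folklore] -/
theorem opNorm_fderiv_sub_le_of_eqOn_slice {F : Type*} [NormedAddCommGroup F] [NormedSpace ℝ F]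
    {f g : E4 → F} {x : E4} (hf : DifferentiableAt ℝ f x) (hg : DifferentiableAt ℝ g x)
    (h : ∀ z : E4, z 0 = x 0 → f z = g z) :
    ‖fderiv ℝ f x - fderiv ℝ g x‖ ≤ ‖fderiv ℝ f x (E4.basisVector 0) - fderiv ℝ g x (E4.basisVector 0)‖ := by
  refine ContinuousLinearMap.opNorm_le_bound _ (norm_nonneg _) fun v ↦ ?_
  obtain ⟨hw0, hwn, hv0⟩ := WindowBounds.split_time_space v
  set w : E4 := v - v 0 • E4.basisVector 0 with hw
  have hv : v = v 0 • E4.basisVector 0 + w := by rw [hw]; abel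
  have hsp : fderiv ℝ f x w = fderiv ℝ g x w := KSDecay.fderiv_apply_eq_of_eqOn_slice hf hg h hw0
  rw [_root_.sub_apply]
  conv_lhs => rw [hv]
  rw [map_add, map_add, map_smul, map_smul, hsp, add_sub_add_right_eq_sub, ← smul_sub, norm_smul,
    Real.norm_eq_abs, mul_comm]
  exact mul_le_mul_of_nonneg_left hv0 (norm_nonneg _)

/-! ### Painted versus frozen summand on the slice -/

/-- On the slice `{z⁰ = t}` the painted summand of a hole is its frozen field at lab time `t`. [folklore] -/
theorem painted_eq_frozen_of_apply_zero (Λ : ℝ → lorentzGroup) (ξ : ℝ → E3) (M a : ℝ) {t : ℝ}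
    {z : E4} (hz : z 0 = t) :
    boostedKerrBilin (Λ (z 0)) (E4.ofTimeSpace (z 0) (ξ (z 0))) M a z =
      boostedKerrBilin (Λ t) (E4.ofTimeSpace t (ξ t)) M a z := by
  rw [hz]

-- operator-norm instance paths on form-valued maps are slow to unify
set_option synthInstance.maxHeartbeats 200000 in
/-- **`‖D(painted)(x) − D(frozen)(x)‖` is the modulation defect.** With the universal constants of
`norm_fderiv_summand_sub_frozen_basisVector_zero_le`: under its hypotheses (a `C¹` motion with
`|(Λ(t)e₀)⁰| ≤ γ`, `C¹` centre, slab point at lab distance `d ≥ max 1 (2|a|)`, stabiliser-corrected rate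
`≤ ν`), the full derivatives of the painted summand and of the frozen field at `x` differ in operator
norm by at most `|M| G² ((B₁G + 2B₀) ν / d + B₁ G ‖ξ̇(t) − v(Λ t)‖ / d²)`. [cite: KerrSchild1965, §3] -/
theorem opNorm_fderiv_painted_sub_frozen_le :
    ∃ B₀ B₁ : ℝ, 0 ≤ B₀ ∧ 0 ≤ B₁ ∧ ∀ (M a γ : ℝ) (Λ : ℝ → lorentzGroup) (ξ : ℝ → E3) (t : ℝ)
      (x : E4) (SK : E4 →L[ℝ] E4) (ν : ℝ),
      ContDiff ℝ 1 (fun s ↦ ((Λ s : E4 ≃L[ℝ] E4) : E4 →L[ℝ] E4)) → ContDiff ℝ 1 ξ →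
      |((Λ t : E4 ≃L[ℝ] E4) (E4.basisVector 0)) 0| ≤ γ → x 0 = t →
      max 1 (2 * |a|) ≤ ‖E4.spatial x - ξ t‖ → 0 ≤ ν →
      (∀ v w, fderiv ℝ (fun y ↦ Kerr.bilin M a y - Minkowski.bilin)
          ((((Λ t : E4 ≃L[ℝ] E4).symm : E4 →L[ℝ] E4)) (E4.spaceEmbed (E4.spatial x - ξ t)))
          (SK ((((Λ t : E4 ≃L[ℝ] E4).symm : E4 →L[ℝ] E4)) (E4.spaceEmbed (E4.spatial x - ξ t))))
          v w +
        (Kerr.bilin M a ((((Λ t : E4 ≃L[ℝ] E4).symm : E4 →L[ℝ] E4))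
          (E4.spaceEmbed (E4.spatial x - ξ t))) - Minkowski.bilin) (SK v) w +
        (Kerr.bilin M a ((((Λ t : E4 ≃L[ℝ] E4).symm : E4 →L[ℝ] E4))
          (E4.spaceEmbed (E4.spatial x - ξ t))) - Minkowski.bilin) v (SK w) = 0) →
      (∀ u, ‖((((Λ t : E4 ≃L[ℝ] E4).symm : E4 →L[ℝ] E4)).comp
          (deriv (fun s ↦ ((Λ s : E4 ≃L[ℝ] E4) : E4 →L[ℝ] E4)) t) - SK) u‖ ≤ ν * ‖u‖) →
      ‖fderiv ℝ (fun y : E4 ↦ boostedKerrBilin (Λ (y 0)) (E4.ofTimeSpace (y 0) (ξ (y 0))) M a y) x -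
        fderiv ℝ (boostedKerrBilin (Λ t) (E4.ofTimeSpace t (ξ t)) M a) x‖ ≤
        |M| * (1 + 3 * γ) ^ 2 * ((B₁ * (1 + 3 * γ) + 2 * B₀) * ν / ‖E4.spatial x - ξ t‖ +
          B₁ * (1 + 3 * γ) * ‖deriv ξ t - (((Λ t : E4 ≃L[ℝ] E4) (E4.basisVector 0)) 0)⁻¹ •
            E4.spatial ((Λ t : E4 ≃L[ℝ] E4) (E4.basisVector 0))‖ / ‖E4.spatial x - ξ t‖ ^ 2) := by
  obtain ⟨B₀, B₁, hB₀, hB₁, h⟩ := norm_fderiv_summand_sub_frozen_basisVector_zero_le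
  refine ⟨B₀, B₁, hB₀, hB₁, fun M a γ Λ ξ t x SK ν hΛ hξ hγ hx hd hν hstab hrate ↦ ?_⟩
  -- differentiability of both fields at `x`
  have hS1 := (contDiffAt_summand (M := M) (a := a) hΛ hξ hx hd).differentiableAt one_ne_zero
  have hrad : 0 < Kerr.radius a (poincareInv (Λ t) (E4.ofTimeSpace t (ξ t)) x) := by
    refine Kerr.radius_pos_of_abs_lt ?_
    have h1 := KSDecay.norm_sub_le_spatialNorm_poincareInv (Λ t) (ξ t) x
    rw [hx] at h1
    exact ((abs_lt_max_one_two_mul_abs a).trans_le hd).trans_le h1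
  have hF : DifferentiableAt ℝ (boostedKerrBilin (Λ t) (E4.ofTimeSpace t (ξ t)) M a) x :=
    (contDiffAt_boostedKerrBilin (Λ t) _ M a hrad (n := 1)).differentiableAt one_ne_zero
  have hS : DifferentiableAt ℝ
      (fun y : E4 ↦ boostedKerrBilin (Λ (y 0)) (E4.ofTimeSpace (y 0) (ξ (y 0))) M a y) x := by
    have h2 := hS1.add_const Minkowski.bilin
    simpa only [sub_add_cancel] using h2
  -- spatial derivatives agree; the time derivatives differ by the defect
  have hslice := opNorm_fderiv_sub_le_of_eqOn_slice hS hF fun z hz ↦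
    painted_eq_frozen_of_apply_zero Λ ξ M a (hz.trans hx)
  refine hslice.trans ?_
  have hsub1 : fderiv ℝ (fun y : E4 ↦ boostedKerrBilin (Λ (y 0)) (E4.ofTimeSpace (y 0) (ξ (y 0))) M a y) x =
      fderiv ℝ (fun y : E4 ↦ boostedKerrBilin (Λ (y 0)) (E4.ofTimeSpace (y 0) (ξ (y 0))) M a y -
        Minkowski.bilin) x := by
    rw [fderiv_sub_const]
  have hsub2 : fderiv ℝ (boostedKerrBilin (Λ t) (E4.ofTimeSpace t (ξ t)) M a) x =
      fderiv ℝ (fun y : E4 ↦ boostedKerrBilin (Λ t) (E4.ofTimeSpace t (ξ t)) M a y - Minkowski.bilin) x := by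
    rw [fderiv_sub_const]
  rw [hsub1, hsub2]
  exact h M a γ Λ ξ t x SK ν hΛ hξ hγ hx hd hν hstab hrate

/-! ### Value and derivative bounds of a frozen summand at lab distance `d` -/

-- operator-norm instance paths on form-valued maps are slow to unify
set_option synthInstance.maxHeartbeats 200000 in
/-- **Value bound of a boosted, translated Kerr–Schild summand**: with the universal constant `B₀` of
`exists_norm_ksPert_le`, at a slab point `x` (`x⁰ = t`) at lab distance `d = ‖x̃ − ξ₀‖ ≥ max 1 (2|a|)`
from the centre, `‖boostedKerrBilin Λ (t, ξ₀) M a x − η‖ ≤ ‖Λ⁻¹‖² |M| B₀ / d`.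
[cite: KerrSchild1965, §3] -/
theorem norm_frozen_sub_minkowski_le :
    ∃ B₀ : ℝ, 0 ≤ B₀ ∧ ∀ (Λ : lorentzGroup) (ξ₀ : E3) (M a t : ℝ) (x : E4), x 0 = t →
      max 1 (2 * |a|) ≤ ‖E4.spatial x - ξ₀‖ →
      ‖boostedKerrBilin Λ (E4.ofTimeSpace t ξ₀) M a x - Minkowski.bilin‖ ≤
        ‖(((Λ : E4 ≃L[ℝ] E4).symm : E4 →L[ℝ] E4))‖ ^ 2 * (|M| * B₀ / ‖E4.spatial x - ξ₀‖) := by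
  obtain ⟨B₀, hB₀, hK0⟩ := exists_norm_ksPert_le
  refine ⟨B₀, hB₀, fun Λ ξ₀ M a t x hx hd ↦ ?_⟩
  set A : E4 →L[ℝ] E4 := (((Λ : E4 ≃L[ℝ] E4).symm : E4 →L[ℝ] E4)) with hA
  set p : E4 := poincareInv Λ (E4.ofTimeSpace t ξ₀) x with hp
  have hd1 : 1 ≤ ‖E4.spatial x - ξ₀‖ := (le_max_left _ _).trans hd
  have hd0 : 0 < ‖E4.spatial x - ξ₀‖ := one_pos.trans_le hd1
  have hσ : ‖E4.spatial x - ξ₀‖ ≤ E4.spatialNorm p := by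
    have h := KSDecay.norm_sub_le_spatialNorm_poincareInv Λ ξ₀ x
    rwa [hx] at h
  have hσ' : max 1 (2 * |a|) ≤ E4.spatialNorm p := hd.trans hσ
  have hKp : ‖Kerr.bilin M a p - Minkowski.bilin‖ ≤ |M| * B₀ / ‖E4.spatial x - ξ₀‖ :=
    (hK0 M a p hσ').trans (div_le_div_of_nonneg_left (by positivity) hd0 hσ)
  refine ContinuousLinearMap.opNorm_le_bound₂ _ (by positivity) fun v w ↦ ?_
  rw [boostedKerrBilin_sub_minkowski_apply]
  have h1 := (Kerr.bilin M a p - Minkowski.bilin).le_opNorm₂ (A v) (A w)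
  refine h1.trans ?_
  have hAv : ‖A v‖ ≤ ‖A‖ * ‖v‖ := A.le_opNorm v
  have hAw : ‖A w‖ ≤ ‖A‖ * ‖w‖ := A.le_opNorm w
  calc ‖Kerr.bilin M a p - Minkowski.bilin‖ * ‖A v‖ * ‖A w‖
      ≤ (|M| * B₀ / ‖E4.spatial x - ξ₀‖) * (‖A‖ * ‖v‖) * (‖A‖ * ‖w‖) := by
        gcongr
    _ = ‖A‖ ^ 2 * (|M| * B₀ / ‖E4.spatial x - ξ₀‖) * ‖v‖ * ‖w‖ := by ring

-- operator-norm instance paths on form-valued maps are slow to unify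
set_option synthInstance.maxHeartbeats 200000 in
/-- **Derivative bound of a frozen summand at lab distance `d`**: with the constants `C, R₀` of
`KSDecay.norm_fderiv_boostedKerrBilin_le`, at a slab point `x` (`x⁰ = t`) with `R₀ + |a| ≤ d = ‖x̃ − ξ₀‖`,
`‖D(boostedKerrBilin Λ (t, ξ₀) M a)(x)‖ ≤ C ‖Λ⁻¹‖³ / d²`. [cite: KerrSchild1965, §3] -/
theorem norm_fderiv_frozen_le (M a : ℝ) :
    ∃ C R₀ : ℝ, 0 ≤ C ∧ 0 < R₀ ∧ ∀ (Λ : lorentzGroup) (ξ₀ : E3) (t : ℝ) (x : E4), x 0 = t →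
      R₀ + |a| ≤ ‖E4.spatial x - ξ₀‖ →
      DifferentiableAt ℝ (boostedKerrBilin Λ (E4.ofTimeSpace t ξ₀) M a) x ∧
      ‖fderiv ℝ (boostedKerrBilin Λ (E4.ofTimeSpace t ξ₀) M a) x‖ ≤
        ‖(((Λ : E4 ≃L[ℝ] E4).symm : E4 →L[ℝ] E4))‖ ^ 3 * C / ‖E4.spatial x - ξ₀‖ ^ 2 := by
  obtain ⟨C, R₀, hC, hR₀, h⟩ := KSDecay.norm_fderiv_boostedKerrBilin_le M a
  refine ⟨C, R₀, hC, hR₀, fun Λ ξ₀ t x hx hfar ↦ ?_⟩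
  have hrad : R₀ ≤ Kerr.radius a (poincareInv Λ (E4.ofTimeSpace t ξ₀) x) := by
    have h1 := KSDecay.le_radius_poincareInv_of_far Λ a ξ₀ (y := x) hR₀.le hfar
    rwa [hx] at h1
  obtain ⟨hd, hb⟩ := h Λ (E4.ofTimeSpace t ξ₀) x hrad
  refine ⟨hd, hb.trans ?_⟩
  have hd0 : 0 < ‖E4.spatial x - ξ₀‖ := (add_pos_of_pos_of_nonneg hR₀ (abs_nonneg a)).trans_le hfar
  have hσ : ‖E4.spatial x - ξ₀‖ ≤ E4.spatialNorm (poincareInv Λ (E4.ofTimeSpace t ξ₀) x) := by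
    have h1 := KSDecay.norm_sub_le_spatialNorm_poincareInv Λ ξ₀ x
    rwa [hx] at h1
  rw [mul_comm (‖(((Λ : E4 ≃L[ℝ] E4).symm : E4 →L[ℝ] E4))‖ ^ 3) C]
  exact div_le_div_of_nonneg_left (by positivity) (by positivity) (pow_le_pow_left₀ hd0.le hσ 2)

/-! ### The enclosure hypothesis for the sphere about the painted centre -/

/-- **The lab trace of the rest-frame ball `{|z| ≤ |a|}` lies in the ball of radius `ρ₀ > |a|` about the
painted centre** (boosts only stretch spatial vectors): the enclosure hypothesis of
`quasiLocalMomentum_boostedKerr_energy/_momentum` for the small sphere of the identification. [folklore] -/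
theorem mem_ball_of_spatialNorm_poincareInv_le (Λ : lorentzGroup) (ξ₀ : E3) {a t ρ₀ : ℝ} (hρ₀ : |a| < ρ₀)
    (y : E3) (hy : ‖E4.spatial (poincareInv Λ (E4.ofTimeSpace t ξ₀) (E4.ofTimeSpace t y))‖ ≤ |a|) :
    y ∈ ball ξ₀ ρ₀ := by
  rw [mem_ball, dist_eq_norm]
  have h := KSDecay.norm_sub_le_spatialNorm_poincareInv Λ ξ₀ (E4.ofTimeSpace t y)
  rw [E4.ofTimeSpace_apply_zero, E4.spatial_ofTimeSpace] at h
  exact (h.trans hy).trans_lt hρ₀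

/-- Registered sub-goal form (stub `ll_restBall_trace_mem_ball` of the crux item) of
`mem_ball_of_spatialNorm_poincareInv_le`: the lab trace of the rest-frame ball `{|z| ≤ |a|}` of a hole
lies in the lab ball of any radius `ρ₀ > |a|` about the painted centre. [folklore] -/
theorem _root_.Summit.FinalStateConjecture.FinalStateConjecture.Theorems.ll_restBall_trace_mem_ball : open Literature.Geometry.Lorentzian Metric in ∀ (Λ : lorentzGroup) (ξ₀ : EuclideanSpace ℝ (Fin 3)) {a t ρ₀ : ℝ}, |a| < ρ₀ → ∀ y : EuclideanSpace ℝ (Fin 3), ‖E4.spatial (poincareInv Λ (E4.ofTimeSpace t ξ₀) (E4.ofTimeSpace t y))‖ ≤ |a| → y ∈ ball ξ₀ ρ₀ :=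
  fun Λ ξ₀ _a _t _ρ₀ hρ₀ y hy ↦ mem_ball_of_spatialNorm_poincareInv_le Λ ξ₀ hρ₀ y hy

end Summit.FinalStateConjecture.FinalStateConjecture.Theorems.SublinearIsFree.ChargeModel

end
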